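import Summits.QuantumFields.YangMills.Theorems.AlphaInputsT3ACWeightedInverseChart
import Summits.QuantumFields.YangMills.Theorems.AlphaInputsT3ACEMLFibreCoreInjective
import Summits.QuantumFields.YangMills.Theorems.AlphaInputsT3ACWeightedFibreFormula
import Literature.MathematicalPhysics.QuantumFieldTheory.Balaban1983to89.T4AveragingDisintegration
import Literature.MathematicalPhysics.QuantumFieldTheory.Balaban1983to89.LatticeWordStokes
import Literature.MathematicalPhysics.QuantumFieldTheory.Balaban1983to89.BlockAveragingSection
import Literature.MathematicalPhysics.QuantumFieldTheory.Balaban1983to89.T3DescentFibreTower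
import Summits.QuantumFields.Balaban3D.Proofs.Bound55Masses
import HarnessLib

/-!
# `AlphaInputsT3ACBlockAvgEMLWeightedFibreChart` — (B2-F2) A WEIGHTED FIBRE CHART OF BAŁABAN'S BLOCK AVERAGING (0.4) WITH THE PRINTED
# `exp[mean log]` ON THE SMALL-LOOP REGION, and the fibre formula for its Radon–Nikodym transport (cell ym3-torus, desk pub/ym-inputs
# INPUT-LIST v8 §3 I-10 ∕ I-12, memos `I10-B2-FIBRE-LOCATE-p08.md` §6 ∕ `B2F2-CHART-LOCATE-p08g3.md`; seat ym-inputs-p08 g3; helper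
# `--supports stmt-QuantumFields-20520`)

WHAT.  For `G = SU(N)` (the T³ record: `N = 2`, `ℰp = expMeanLogSU`), a torus in the standing range `j + 1 ≤ m + K`, and the gauge-invariant
SMALL-LOOP REGION `O_ε = {U | ∀ c i, dist1 (loopHol U c i) < ε}` ([Balaban1987RG1] (0.4): every loop variable `U(Γ ∪ [x,x′] ∪ (−Γ′) ∪ (−c))` within
`ε` of `1`; it contains the small-plaquette fields, `LatticeWordStokes.dist1_loopHol_le`) with `10ε ≤ |I|⁻¹` (`|I| = L^d (d!)²` the index set of
(0.4)) and `ε ≤ δ_N`, THERE ARE measurable `Φ : (V, U′) ↦ U`, `J ≥ 0`, `S` such that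
`((((dV ⊗ dU′)↾S).withDensity J).map Φ = dU↾O_ε`, `Ū(Φ z) = z.1` and `Φ z ∈ O_ε` on `S`, and every `U ∈ O_ε` is charted (`exists_weightedFibreChart`);
hence, through the socket `WeightedFibreFormula.rnTransport_ae_eq_weightedFibreIntegral_local`, **for every integrable density `ρ` supported in
`O_ε`: `(Tρ)(V) = ∫ 𝟙_S(V,U′)·J(V,U′)·ρ(Φ(V,U′)) dU′` for dV-a.e. `V`** (`exists_chart_rnTransport_ae_eq`) — the `hchart`-shaped input of the two
trivial-history rows of `…AlphaInputsT3ACv3StepTrivPinsChart` (local form `…ChartLocal`), LOCAL in `ρ`, with parameter space the fine fields themselves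
(the environment `U′`) under product Haar measure; §4 supplies those rows' displayed window inclusion `{χB_k(triv′) ≠ 0} ⊆ O_ε` at the record's cut-off
(`loopSmall_of_chiB_triv_ne_zero`: `Hist.last_triv`, `Carriers.Omega_triv`, `LatticeWordStokes.dist1_loopHol_le`, size condition `((d+2)L)²ε₁(k)/4 < ε`).

HOW (the private-coordinate route of `…AlphaInputsT3ACWeightedInverseChart`, no gauge fixing).  In the private coordinates `β = centralBond`
(`BlockAveragingHaarAC.centralBond_injective`, `isLocal_avgFun`) the resampled field `res (U′, g) = Function.extend β g U′` has loop variables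
`loopHol (res (U′,g)) c = fibreFamily U′ c (pre·g c·post)` (`loopHol_extend_eq_fibreFamily`) and block average `Ū(res (U′,g))(c) =
fibreMap (pre·g c·post)` (`avgFun_extend_eq_fibreMap`, `BlockAveragingEMLHaarAC.avgFun_update_centralBond_self`) — DIAGONAL in `g`.  The
one-variable laws are absolutely continuous on `SU(N)`, every `N` (`map_haar_update_avgFun_absolutelyContinuous` ⇐ `BlockAveragingEMLHaarACSUN` ∕
`…EMLFibreLawSUN.emlFibreLaw_fin`), and on the `ε`-guard the guarded fibre map is injective (`fibreMap_injective_of_small` ⇐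
`…EMLFibreCoreInjective.fibreCore_injective_of_small`, `coe_fibreCore_eq`); so `WeightedInverseChart.exists_weightedChart_of_isLocal` applies.
The weight `J` is the Radon–Nikodym derivative it produces — NOT print's Jacobian `det(I − (δ/δA)D̃(A))·Πσ/σ₀` of [Balaban1985UV3] (18), (20)–(21)
(that explicit form is B2's analytic content, not needed for the identity-level rows).

HONEST SCOPE.  [folklore] measure theory + one contraction estimate about the published formula (0.4); nothing of Bałaban's estimates is asserted;
count-neutral; no summit ∕ sub-problem statement proved (rung R3 bookkeeping; not T⁴, not Clay; the Yang–Mills mass gap is NOT proved).  Def-free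
(objects are ∃-packaged; a B0 definer may NAME them by `Classical.choose`); L-floor: none (`j + 1 ≤ m + K` only).
References: T. Bałaban, CMP 109 (1987) 249–301 [Balaban1987RG1] ((0.4) p.253); CMP 102 (1985) 255–275 [Balaban1985UV3] ((13)–(18) pp.259–260,
(49)–(51) p.268); CMP 98 (1985) 17–51 [Balaban1985Averaging] ((10) p.19).
-/

set_option autoImplicit false

noncomputable section

namespace Summit.QuantumFields.YangMills.Theorems.BlockAvgEMLWeightedFibreChart

open MeasureTheory Set Function
open scoped ENNReal NNReal Matrix.Norms.L2Operator
open Literature.MathematicalPhysics.QuantumFieldTheory.Balaban1983to89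
open Literature.MathematicalPhysics.QuantumFieldTheory.Balaban1983to89.T4Continuum
open Literature.MathematicalPhysics.QuantumFieldTheory.Balaban1983to89.AveragingRT (rnTransport)
open Literature.MathematicalPhysics.QuantumFieldTheory.Balaban1983to89.BlockAveraging
open Literature.MathematicalPhysics.QuantumFieldTheory.Balaban1983to89.BlockAveragingHaarAC
open Literature.MathematicalPhysics.QuantumFieldTheory.Balaban1983to89.BlockAveragingEMLHaarAC
open Literature.MathematicalPhysics.QuantumFieldTheory.Balaban1983to89.ExpMeanLog (expMeanLogSU measurable_expMeanLogSU_E)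
open Literature.MathematicalPhysics.QuantumFieldTheory.Balaban1983to89.T4TriangularPushforward (IsLocal apply_resample_eq)
open Summit.QuantumFields.Balaban3D.Carriers (AvgAC Hist)
open Summit.QuantumFields.YangMills.Theorems.WeightedInverseChart (exists_weightedChart_of_isLocal)
open Summit.QuantumFields.YangMills.Theorems.EMLFibreCoreInjective (fibreCore_injective_of_small sum_emlWeight_le_one_sub_inv)

variable {P : Params} {j : ℕ}

/-! ## §1 The resampled field in the private coordinates: loop variables and block average are DIAGONAL (every group, every `ℰ`) -/

section Resample

variable {G : Type*} [GaugeGroup G]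

/-- Resampling all private coordinates and then reading the loops at `c` = updating the single private coordinate `β(c)`: the loop words at
`c` contain `β(c′)` only for `c′ = c` (`eq_of_mem_walk_loopWord_of_eq_centralBond`). [folklore] -/
theorem loopHol_extend_centralBond [DecidableEq (PBond P j)] (hj : j + 1 ≤ P.m + P.K) (U : GaugeField P j G)
    (g : PBond P (j + 1) → G) (c : PBond P (j + 1)) :
    loopHol (extend centralBond g U : GaugeField P j G) c = loopHol (update U (centralBond c) (g c)) c := by
  funext i
  unfold loopHol
  refine T4ReflectionCone.holAt_congr fun s hs => ?_
  by_cases h : ∃ c', centralBond c' = s.bond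
  · obtain ⟨c', hc'⟩ := h
    have hcc : c' = c := eq_of_mem_walk_loopWord_of_eq_centralBond hj c c' i hs hc'.symm
    subst hcc
    rw [← hc', (centralBond_injective hj).extend_apply, update_self]
  · rw [extend_apply' _ _ _ h, update_of_ne]
    intro hsb
    exact h ⟨c, hsb.symm⟩

/-- **THE LOOP VARIABLES OF THE RESAMPLED FIELD** at `c` are the W-coordinate family at `W = pre·g(c)·post`
(`BlockAveragingEMLHaarAC.loopHol_update_centralBond_self`). [cite: Balaban1987RG1, (0.4) p.253] -/
theorem loopHol_extend_eq_fibreFamily [DecidableEq (PBond P j)] (hj : j + 1 ≤ P.m + P.K) (U : GaugeField P j G)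
    (g : PBond P (j + 1) → G) (c : PBond P (j + 1)) :
    loopHol (extend centralBond g U : GaugeField P j G) c = fibreFamily U c (pre U c * g c * post U c) := by
  rw [loopHol_extend_centralBond hj, loopHol_update_centralBond_self hj]

/-- **THE BLOCK AVERAGE OF THE RESAMPLED FIELD IS DIAGONAL**: `Ū(res (U′,g))(c) = fibreMap (pre·g(c)·post)` for every small-loop average `ℰ`
(`IsLocal` + `apply_resample_eq` + `avgFun_update_centralBond_self`). [cite: Balaban1987RG1, (0.4) p.253] -/
theorem avgFun_extend_eq_fibreMap [DecidableEq (PBond P j)] (hj : j + 1 ≤ P.m + P.K) (ℰ : LoopAverage G) (U : GaugeField P j G)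
    (g : PBond P (j + 1) → G) (c : PBond P (j + 1)) :
    avgFun ℰ (extend centralBond g U : GaugeField P j G) c = fibreMap ℰ U c (pre U c * g c * post U c) := by
  have h := apply_resample_eq (isLocal_avgFun (P := P) (j := j) (G := G) hj ℰ) (centralBond_injective hj) U g c
  rw [h, avgFun_update_centralBond_self hj]

omit [GaugeGroup G] in
/-- Resampling the private coordinates of `U` by their own values returns `U`. [folklore] -/
theorem extend_centralBond_self (hj : j + 1 ≤ P.m + P.K) (U : GaugeField P j G) :
    (extend centralBond (fun c => U (centralBond c)) U : GaugeField P j G) = U := by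
  funext b
  by_cases h : ∃ c, centralBond c = b
  · obtain ⟨c, rfl⟩ := h
    exact (centralBond_injective hj).extend_apply _ _ _
  · exact extend_apply' _ _ _ h

/-- Membership of the resampled field in the small-loop region is a per-bond guard on the W-coordinate families. [folklore] -/
theorem extend_mem_loopSmall_iff [DecidableEq (PBond P j)] (hj : j + 1 ≤ P.m + P.K) (U : GaugeField P j G)
    (g : PBond P (j + 1) → G) (ε : ℝ) :
    (∀ c i, dist1 (loopHol (extend centralBond g U : GaugeField P j G) c i) < ε) ↔
      ∀ c i, dist1 (fibreFamily U c (pre U c * g c * post U c) i) < ε := by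
  simp only [loopHol_extend_eq_fibreFamily hj]

/-- The small-loop region is measurable. [folklore] -/
theorem measurableSet_loopSmall [MeasurableSpace G] [RegularGaugeGroup G] (ε : ℝ) :
    MeasurableSet {U : GaugeField P j G | ∀ c i, dist1 (loopHol U c i) < ε} := by
  have : {U : GaugeField P j G | ∀ c i, dist1 (loopHol U c i) < ε} = ⋂ c, ⋂ i, {U : GaugeField P j G | dist1 (loopHol U c i) < ε} := by
    ext U; simp only [mem_setOf_eq, mem_iInter]
  rw [this]
  exact MeasurableSet.iInter fun c => MeasurableSet.iInter fun i =>
    measurableSet_lt (RegularGaugeGroup.measurable_dist1.comp ((measurable_pi_apply i).comp (measurable_loopHol c))) measurable_const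

end Resample

/-! ## §2 `SU(N)`: the one-variable inputs — absolute continuity (by name) and injectivity on the small guard -/

section SUN

variable {N : ℕ} [NeZero N]

/-- **ONE-VARIABLE ABSOLUTE CONTINUITY** (every `U`, `c`; `SU(N)`, every `N ≥ 1`): the law of `x ↦ Ū(U[β(c) ↦ x])(c)` under Haar measure is
absolutely continuous — `map_haar_avgFun_update_absolutelyContinuous_of_guard` at the `SU(N)` fibre law `emlFibreLaw_fin`. [folklore] -/
theorem map_haar_update_avgFun_absolutelyContinuous [DecidableEq (PBond P j)] (hj : j + 1 ≤ P.m + P.K)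
    (U : GaugeField P j (Matrix.specialUnitaryGroup (Fin N) ℂ)) (c : PBond P (j + 1)) :
    (HaarData.haar : Measure (Matrix.specialUnitaryGroup (Fin N) ℂ)).map
        (fun x => avgFun expMeanLogSU (update U (centralBond c) x) c) ≪ HaarData.haar :=
  map_haar_avgFun_update_absolutelyContinuous_of_guard hj expMeanLogSU measurable_expMeanLogSU_E U c
    (BlockAveragingEMLHaarACSUN.haar_restrict_fibreGuard_map_absolutelyContinuous_of_fibreLaw
      BlockAveragingEMLFibreLawSUN.emlFibreLaw_fin U c)

/-- **THE FIBRE MAP IS INJECTIVE ON THE SMALL GUARD** (`SU(N)`): if the W-coordinate families of `W₁`, `W₂` are within `ε` of `1`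
(`10ε ≤ |I|⁻¹`, `ε ≤ 1/10`, `ε ≤ δ_N`) and `fibreMap W₁ = fibreMap W₂`, then `W₁ = W₂` — `coe_fibreCore_eq` + `EMLFibreCoreInjective.fibreCore_injective_of_small`
with Bałaban's weights (`sum_emlWeight_le_one_sub_inv`). [cite: Balaban1987RG1, (0.4) p.253] -/
theorem fibreMap_injective_of_small (U : GaugeField P j (Matrix.specialUnitaryGroup (Fin N) ℂ)) (c : PBond P (j + 1))
    {ε : ℝ} (hε0 : 0 ≤ ε) (hε : ε ≤ 1 / 10) (hεI : 10 * ε ≤ ((Fintype.card (Idx P) : ℝ))⁻¹)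
    (hεδ : ε ≤ (expMeanLogSU (n := Fin N)).δ) {W₁ W₂ : Matrix.specialUnitaryGroup (Fin N) ℂ}
    (h₁ : ∀ i, dist1 (fibreFamily U c W₁ i) < ε) (h₂ : ∀ i, dist1 (fibreFamily U c W₂ i) < ε)
    (heq : fibreMap expMeanLogSU U c W₁ = fibreMap expMeanLogSU U c W₂) : W₁ = W₂ := by
  have hW₁ : W₁ ∈ fibreGuard expMeanLogSU U c := fun i => (h₁ i).trans_le hεδ
  have hW₂ : W₂ ∈ fibreGuard expMeanLogSU U c := fun i => (h₂ i).trans_le hεδ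
  rw [fibreMap_of_mem expMeanLogSU U c hW₁, fibreMap_of_mem expMeanLogSU U c hW₂] at heq
  have hmat : ((expMeanLogSU.avg (fibreFamily U c W₁) * W₁ : Matrix.specialUnitaryGroup (Fin N) ℂ) : Matrix (Fin N) (Fin N) ℂ) =
      ((expMeanLogSU.avg (fibreFamily U c W₂) * W₂ : Matrix.specialUnitaryGroup (Fin N) ℂ) : Matrix (Fin N) (Fin N) ℂ) :=
    congrArg (fun X : Matrix.specialUnitaryGroup (Fin N) ℂ => (X : Matrix (Fin N) (Fin N) ℂ)) heq
  rw [coe_fibreCore_eq U c hW₁, coe_fibreCore_eq U c hW₂] at hmat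
  -- the guard in the `h_k W*` currency
  have hg : ∀ (W : Matrix.specialUnitaryGroup (Fin N) ℂ), (∀ i, dist1 (fibreFamily U c W i) < ε) →
      ∀ k : Fin (offCard c), ‖((offHol U c k : Matrix.specialUnitaryGroup (Fin N) ℂ) : Matrix (Fin N) (Fin N) ℂ) *
        star (W : Matrix (Fin N) (Fin N) ℂ) - 1‖ ≤ ε := fun W hW k => by
    have hi := hW ((offEquiv c).symm k).1
    rw [dist1_fibreFamily_of_not_isCentral U c W _ ((offEquiv c).symm k).2] at hi
    exact hi.le
  have hunit : ∀ k : Fin (offCard c), ((offHol U c k : Matrix.specialUnitaryGroup (Fin N) ℂ) : Matrix (Fin N) (Fin N) ℂ) ∈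
      Matrix.unitaryGroup (Fin N) ℂ := fun k => (Matrix.mem_specialUnitaryGroup_iff.mp (offHol U c k).2).1
  have hI : (0 : ℝ) < ((Fintype.card (Idx P) : ℝ))⁻¹ := inv_pos.mpr (Nat.cast_pos.mpr Fintype.card_pos)
  have hcoe : (W₁ : Matrix (Fin N) (Fin N) ℂ) = W₂ :=
    fibreCore_injective_of_small (fun k => ((offHol U c k : Matrix.specialUnitaryGroup (Fin N) ℂ) : Matrix (Fin N) (Fin N) ℂ)) hunit
      (fun _ => emlWeight P) (fun _ => emlWeight_nonneg P) (sum_emlWeight_le_one_sub_inv c) (by linarith) hε0 hε (by linarith)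
      (Matrix.mem_specialUnitaryGroup_iff.mp W₁.2).1 (hg W₁ h₁) (hg W₂ h₂) hmat
  exact Subtype.ext hcoe

end SUN

/-! ## §3 (B2-F2) The weighted fibre chart of `blockAvg expMeanLogSU` on the small-loop region, and the fibre formula for its transport -/

section Chart

variable {N : ℕ} [NeZero N]

/-- **(B2-F2) THE WEIGHTED FIBRE CHART OF BAŁABAN'S BLOCK AVERAGING WITH THE PRINTED AVERAGE ON THE SMALL-LOOP REGION** (`SU(N)`, standing range).
For `0 ≤ ε ≤ 1/10`, `10ε ≤ |I|⁻¹`, `ε ≤ δ_N`: there are measurable `Φ : GaugeField (j+1) × GaugeField j → GaugeField j`, `J ≥ 0` and `S` with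
(i) on `S`, `Ū(Φ z) = z.1` and `Φ z ∈ O_ε`; (ii) every `U ∈ O_ε` is charted: `(Ū U, U) ∈ S` and `Φ (Ū U, U) = U`;
(iii) `((((dV ⊗ dU′)↾S).withDensity J).map Φ = dU↾O_ε` — the hypotheses `hmap`∕`hfib` of `WeightedFibreFormula.rnTransport_ae_eq_weightedFibreIntegral_local`
with fibre parameter the environment `U′ ∼ dU′`.  Print's chart for the same fibres is (13)+(17)+(18) of [Balaban1985UV3]; this one is the
private-coordinate chart (`WeightedInverseChart.exists_weightedChart_of_isLocal`). [cite: Balaban1985UV3, (13)–(18) pp.259–260] -/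
theorem exists_weightedFibreChart (hj : j + 1 ≤ P.m + P.K) {ε : ℝ} (hε0 : 0 ≤ ε) (hε : ε ≤ 1 / 10)
    (hεI : 10 * ε ≤ ((Fintype.card (Idx P) : ℝ))⁻¹) (hεδ : ε ≤ (expMeanLogSU (n := Fin N)).δ) :
    ∃ (Φ : GaugeField P (j + 1) (Matrix.specialUnitaryGroup (Fin N) ℂ) × GaugeField P j (Matrix.specialUnitaryGroup (Fin N) ℂ) →
          GaugeField P j (Matrix.specialUnitaryGroup (Fin N) ℂ))
      (J : GaugeField P (j + 1) (Matrix.specialUnitaryGroup (Fin N) ℂ) × GaugeField P j (Matrix.specialUnitaryGroup (Fin N) ℂ) → ℝ≥0)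
      (S : Set (GaugeField P (j + 1) (Matrix.specialUnitaryGroup (Fin N) ℂ) × GaugeField P j (Matrix.specialUnitaryGroup (Fin N) ℂ))),
      Measurable Φ ∧ Measurable J ∧ MeasurableSet S ∧
      (∀ z ∈ S, avgFun expMeanLogSU (Φ z) = z.1 ∧
        Φ z ∈ {U : GaugeField P j (Matrix.specialUnitaryGroup (Fin N) ℂ) | ∀ c i, dist1 (loopHol U c i) < ε}) ∧
      (∀ U ∈ {U : GaugeField P j (Matrix.specialUnitaryGroup (Fin N) ℂ) | ∀ c i, dist1 (loopHol U c i) < ε},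
        (avgFun expMeanLogSU U, U) ∈ S ∧ Φ (avgFun expMeanLogSU U, U) = U) ∧
      ((((fieldMeasure P (j + 1) (Matrix.specialUnitaryGroup (Fin N) ℂ)).prod
            (fieldMeasure P j (Matrix.specialUnitaryGroup (Fin N) ℂ))).restrict S).withDensity (fun z => (J z : ℝ≥0∞))).map Φ =
        (fieldMeasure P j (Matrix.specialUnitaryGroup (Fin N) ℂ)).restrict
          {U : GaugeField P j (Matrix.specialUnitaryGroup (Fin N) ℂ) | ∀ c i, dist1 (loopHol U c i) < ε} := by
  classical
  set O : Set (GaugeField P j (Matrix.specialUnitaryGroup (Fin N) ℂ)) :=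
    {U : GaugeField P j (Matrix.specialUnitaryGroup (Fin N) ℂ) | ∀ c i, dist1 (loopHol U c i) < ε} with hO
  have hOm : MeasurableSet O := measurableSet_loopSmall ε
  -- the hypotheses of the private-coordinate chart theorem
  have hA : IsLocal (centralBond : PBond P (j + 1) → PBond P j)
      (avgFun expMeanLogSU : GaugeField P j (Matrix.specialUnitaryGroup (Fin N) ℂ) → GaugeField P (j + 1) _) := isLocal_avgFun hj _
  have hβ : Injective (centralBond : PBond P (j + 1) → PBond P j) := centralBond_injective hj
  have hAm : Measurable (avgFun expMeanLogSU : GaugeField P j (Matrix.specialUnitaryGroup (Fin N) ℂ) → GaugeField P (j + 1) _) :=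
    measurable_avgFun expMeanLogSU measurable_expMeanLogSU_E
  have hac : ∀ (U : GaugeField P j (Matrix.specialUnitaryGroup (Fin N) ℂ)) (c : PBond P (j + 1)),
      (HaarData.haar : Measure (Matrix.specialUnitaryGroup (Fin N) ℂ)).map (fun x => avgFun expMeanLogSU (update U (centralBond c) x) c) ≪
        HaarData.haar := fun U c => map_haar_update_avgFun_absolutelyContinuous hj U c
  have hinj : ∀ (U : GaugeField P j (Matrix.specialUnitaryGroup (Fin N) ℂ)) (g g' : PBond P (j + 1) → Matrix.specialUnitaryGroup (Fin N) ℂ),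
      (extend centralBond g U : GaugeField P j _) ∈ O → (extend centralBond g' U : GaugeField P j _) ∈ O →
      avgFun expMeanLogSU (extend centralBond g U : GaugeField P j _) = avgFun expMeanLogSU (extend centralBond g' U : GaugeField P j _) →
      g = g' := by
    intro U g g' hg hg' heq
    have hg1 : ∀ c i, dist1 (fibreFamily U c (pre U c * g c * post U c) i) < ε := (extend_mem_loopSmall_iff hj U g ε).mp hg
    have hg2 : ∀ c i, dist1 (fibreFamily U c (pre U c * g' c * post U c) i) < ε := (extend_mem_loopSmall_iff hj U g' ε).mp hg'
    funext c
    have hc := congrFun heq c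
    rw [avgFun_extend_eq_fibreMap hj, avgFun_extend_eq_fibreMap hj] at hc
    have hW := fibreMap_injective_of_small U c hε0 hε hεI hεδ (hg1 c) (hg2 c) hc
    exact mul_left_cancel (mul_right_cancel hW)
  obtain ⟨Φ, J, S, hΦm, hJm, hSm, hfib, hcov, hmap⟩ :=
    exists_weightedChart_of_isLocal (HaarData.haar : Measure (Matrix.specialUnitaryGroup (Fin N) ℂ)) hA hβ hAm hac hOm hinj
  refine ⟨Φ, J, S, hΦm, hJm, hSm, hfib, fun U hU => ?_, hmap⟩
  have h := hcov U (fun c => U (centralBond c)) (by rw [extend_centralBond_self hj]; exact hU)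
  rwa [extend_centralBond_self hj] at h

/-- The face section `BlockAveragingSection.faceSec` (coarse bond variable on the exiting fine bonds, `1` elsewhere) is measurable. [folklore] -/
theorem measurable_faceSec {G : Type*} [GaugeGroup G] [MeasurableSpace G] :
    Measurable (BlockAveragingSection.faceSec : GaugeField P (j + 1) G → GaugeField P j G) := by
  refine measurable_pi_lambda _ fun b => ?_
  by_cases h : BlockAveragingSection.ExitsBlock b
  · simp only [BlockAveragingSection.faceSec, if_pos h]; exact measurable_pi_apply _
  · simp only [BlockAveragingSection.faceSec, if_neg h]; exact measurable_const

/-- **THE CHART WITH A GLOBAL FIBRE LANDING** (the `hfibΦ : ∀ V ω, Ū(Φ(V,ω)) = V` of `PinnedStepTrivPins.fibre55WinAC_triv_of_(local)Chart`): splice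
the chart of `exists_weightedFibreChart` off `S` with the face section (`BlockAveragingSection.avgFun_faceSec`, `ℰ(1,…,1) = 1` for the printed average,
`T3DescentFibreTower.expMeanLogSU_E_one`) — the measure identity is unchanged because `((dV⊗dU′)↾S).withDensity J` lives on `S`.
[cite: Balaban1987RG1, (0.4) p.253] -/
theorem exists_weightedFibreChart_global (hj : j + 1 ≤ P.m + P.K) {ε : ℝ} (hε0 : 0 ≤ ε) (hε : ε ≤ 1 / 10)
    (hεI : 10 * ε ≤ ((Fintype.card (Idx P) : ℝ))⁻¹) (hεδ : ε ≤ (expMeanLogSU (n := Fin N)).δ) :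
    ∃ (Φ : GaugeField P (j + 1) (Matrix.specialUnitaryGroup (Fin N) ℂ) × GaugeField P j (Matrix.specialUnitaryGroup (Fin N) ℂ) →
          GaugeField P j (Matrix.specialUnitaryGroup (Fin N) ℂ))
      (J : GaugeField P (j + 1) (Matrix.specialUnitaryGroup (Fin N) ℂ) × GaugeField P j (Matrix.specialUnitaryGroup (Fin N) ℂ) → ℝ≥0)
      (S : Set (GaugeField P (j + 1) (Matrix.specialUnitaryGroup (Fin N) ℂ) × GaugeField P j (Matrix.specialUnitaryGroup (Fin N) ℂ))),
      Measurable Φ ∧ Measurable J ∧ MeasurableSet S ∧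
      (∀ z, avgFun expMeanLogSU (Φ z) = z.1) ∧
      (∀ z ∈ S, Φ z ∈ {U : GaugeField P j (Matrix.specialUnitaryGroup (Fin N) ℂ) | ∀ c i, dist1 (loopHol U c i) < ε}) ∧
      (∀ U ∈ {U : GaugeField P j (Matrix.specialUnitaryGroup (Fin N) ℂ) | ∀ c i, dist1 (loopHol U c i) < ε},
        (avgFun expMeanLogSU U, U) ∈ S ∧ Φ (avgFun expMeanLogSU U, U) = U) ∧
      ((((fieldMeasure P (j + 1) (Matrix.specialUnitaryGroup (Fin N) ℂ)).prod
            (fieldMeasure P j (Matrix.specialUnitaryGroup (Fin N) ℂ))).restrict S).withDensity (fun z => (J z : ℝ≥0∞))).map Φ =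
        (fieldMeasure P j (Matrix.specialUnitaryGroup (Fin N) ℂ)).restrict
          {U : GaugeField P j (Matrix.specialUnitaryGroup (Fin N) ℂ) | ∀ c i, dist1 (loopHol U c i) < ε} := by
  classical
  obtain ⟨Φ₀, J, S, hΦm, hJm, hSm, hfib, hcov, hmap⟩ := exists_weightedFibreChart (N := N) hj hε0 hε hεI hεδ
  set Φ : GaugeField P (j + 1) (Matrix.specialUnitaryGroup (Fin N) ℂ) × GaugeField P j (Matrix.specialUnitaryGroup (Fin N) ℂ) →
      GaugeField P j (Matrix.specialUnitaryGroup (Fin N) ℂ) := S.piecewise Φ₀ (fun z => BlockAveragingSection.faceSec z.1) with hΦ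
  have hsec : ∀ V : GaugeField P (j + 1) (Matrix.specialUnitaryGroup (Fin N) ℂ),
      avgFun expMeanLogSU (BlockAveragingSection.faceSec V) = V := fun V =>
    BlockAveragingSection.avgFun_faceSec hj expMeanLogSU T3DescentFibreTower.expMeanLogSU_E_one V
  refine ⟨Φ, J, S, hΦm.piecewise hSm (measurable_faceSec.comp measurable_fst), hJm, hSm, fun z => ?_, fun z hz => ?_, fun U hU => ?_, ?_⟩
  · by_cases hz : z ∈ S
    · rw [hΦ, Set.piecewise_eq_of_mem _ _ _ hz]; exact (hfib z hz).1
    · rw [hΦ, Set.piecewise_eq_of_notMem _ _ _ hz]; exact hsec z.1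
  · rw [hΦ, Set.piecewise_eq_of_mem _ _ _ hz]; exact (hfib z hz).2
  · obtain ⟨h1, h2⟩ := hcov U hU
    exact ⟨h1, by rw [hΦ, Set.piecewise_eq_of_mem _ _ _ h1]; exact h2⟩
  · rw [← hmap]
    refine Measure.map_congr ?_
    have hae : ∀ᵐ z ∂((((fieldMeasure P (j + 1) (Matrix.specialUnitaryGroup (Fin N) ℂ)).prod
        (fieldMeasure P j (Matrix.specialUnitaryGroup (Fin N) ℂ))).restrict S).withDensity (fun z => (J z : ℝ≥0∞))), z ∈ S :=
      (withDensity_absolutelyContinuous _ _).ae_le (ae_restrict_mem hSm)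
    filter_upwards [hae] with z hz
    rw [hΦ, Set.piecewise_eq_of_mem _ _ _ hz]

/-- `AvgAC` (measurable + push-forward absolutely continuous) for `blockAvg expMeanLogSU` on `SU(N)` in the standing range — by name
(`measurable_avgFun`, `BlockAveragingEMLFibreLawSUN.haarAC_avgFun_expMeanLogSU_SUN`). [folklore] -/
theorem avgAC_avgFun_expMeanLogSU (hj : j + 1 ≤ P.m + P.K) :
    AvgAC (avgFun expMeanLogSU : GaugeField P j (Matrix.specialUnitaryGroup (Fin N) ℂ) → GaugeField P (j + 1) _) :=
  ⟨measurable_avgFun expMeanLogSU measurable_expMeanLogSU_E, BlockAveragingEMLFibreLawSUN.haarAC_avgFun_expMeanLogSU_SUN hj⟩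

/-- ★ **(B2-F2) THE FIBRE FORMULA FOR THE TRANSPORT OF BAŁABAN'S BLOCK AVERAGING WITH THE PRINTED AVERAGE, ON THE SMALL-LOOP REGION.**
`SU(N)`, `j + 1 ≤ m + K`, `0 ≤ ε ≤ 1/10`, `10ε ≤ |I|⁻¹`, `ε ≤ δ_N`: there are measurable `Φ`, `J ≥ 0`, `S` as in `exists_weightedFibreChart` such that
for EVERY integrable density `ρ` vanishing off `O_ε = {U | ∀ c i, dist1 (loopHol U c i) < ε}`,
`rnTransport Ū ρ =ᵐ[dV] V ↦ ∫ 𝟙_S(V,U′)·J(V,U′)·ρ(Φ(V,U′)) dU′` — the `hchart`-shaped input of `…v3StepTrivPinsChart` for the T³ record's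
averaging, local in `ρ` (no gauge invariance needed), via `WeightedFibreFormula.rnTransport_ae_eq_weightedFibreIntegral_local`.
[cite: Balaban1985UV3, (13)–(18) pp.259–260 + (49)–(51) p.268] -/
theorem exists_chart_rnTransport_ae_eq (hj : j + 1 ≤ P.m + P.K) {ε : ℝ} (hε0 : 0 ≤ ε) (hε : ε ≤ 1 / 10)
    (hεI : 10 * ε ≤ ((Fintype.card (Idx P) : ℝ))⁻¹) (hεδ : ε ≤ (expMeanLogSU (n := Fin N)).δ) :
    ∃ (Φ : GaugeField P (j + 1) (Matrix.specialUnitaryGroup (Fin N) ℂ) × GaugeField P j (Matrix.specialUnitaryGroup (Fin N) ℂ) →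
          GaugeField P j (Matrix.specialUnitaryGroup (Fin N) ℂ))
      (J : GaugeField P (j + 1) (Matrix.specialUnitaryGroup (Fin N) ℂ) × GaugeField P j (Matrix.specialUnitaryGroup (Fin N) ℂ) → ℝ≥0)
      (S : Set (GaugeField P (j + 1) (Matrix.specialUnitaryGroup (Fin N) ℂ) × GaugeField P j (Matrix.specialUnitaryGroup (Fin N) ℂ))),
      Measurable Φ ∧ Measurable J ∧ MeasurableSet S ∧
      (∀ z ∈ S, avgFun expMeanLogSU (Φ z) = z.1 ∧
        Φ z ∈ {U : GaugeField P j (Matrix.specialUnitaryGroup (Fin N) ℂ) | ∀ c i, dist1 (loopHol U c i) < ε}) ∧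
      (∀ U ∈ {U : GaugeField P j (Matrix.specialUnitaryGroup (Fin N) ℂ) | ∀ c i, dist1 (loopHol U c i) < ε},
        (avgFun expMeanLogSU U, U) ∈ S ∧ Φ (avgFun expMeanLogSU U, U) = U) ∧
      ∀ (ρ : Density P j (Matrix.specialUnitaryGroup (Fin N) ℂ)),
        Integrable ρ (fieldMeasure P j (Matrix.specialUnitaryGroup (Fin N) ℂ)) →
        (∀ U, U ∉ {U : GaugeField P j (Matrix.specialUnitaryGroup (Fin N) ℂ) | ∀ c i, dist1 (loopHol U c i) < ε} → ρ U = 0) →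
        rnTransport (avgFun expMeanLogSU) ρ =ᵐ[fieldMeasure P (j + 1) (Matrix.specialUnitaryGroup (Fin N) ℂ)] fun V =>
          ∫ U', S.indicator (fun z => (J z : ℝ) * ρ (Φ z)) (V, U') ∂(fieldMeasure P j (Matrix.specialUnitaryGroup (Fin N) ℂ)) := by
  obtain ⟨Φ, J, S, hΦm, hJm, hSm, hfib, hcov, hmap⟩ := exists_weightedFibreChart (N := N) hj hε0 hε hεI hεδ
  refine ⟨Φ, J, S, hΦm, hJm, hSm, hfib, hcov, fun ρ hρ hsupp => ?_⟩
  exact WeightedFibreFormula.rnTransport_ae_eq_weightedFibreIntegral_local (avgAC_avgFun_expMeanLogSU hj) hΦm hJm hSm hmap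
    (fun z hz => (hfib z hz).1) ρ hρ hsupp

/-- The same for the `Setup.Averaging` inhabitant `blockAvg expMeanLogSU` (`(blockAvg ℰ).avg = avgFun ℰ`; at `N = 2` this is the T³ record's
`ℰp` of `T3UnitLawDensityEML` ∕ `AlphaInputsT3AC.avT3_of_le`). [cite: Balaban1987RG1, (0.4) p.253] -/
theorem exists_chart_rnTransport_blockAvg_ae_eq (hj : j + 1 ≤ P.m + P.K) {ε : ℝ} (hε0 : 0 ≤ ε) (hε : ε ≤ 1 / 10)
    (hεI : 10 * ε ≤ ((Fintype.card (Idx P) : ℝ))⁻¹) (hεδ : ε ≤ (expMeanLogSU (n := Fin N)).δ) :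
    ∃ (Φ : GaugeField P (j + 1) (Matrix.specialUnitaryGroup (Fin N) ℂ) × GaugeField P j (Matrix.specialUnitaryGroup (Fin N) ℂ) →
          GaugeField P j (Matrix.specialUnitaryGroup (Fin N) ℂ))
      (J : GaugeField P (j + 1) (Matrix.specialUnitaryGroup (Fin N) ℂ) × GaugeField P j (Matrix.specialUnitaryGroup (Fin N) ℂ) → ℝ≥0)
      (S : Set (GaugeField P (j + 1) (Matrix.specialUnitaryGroup (Fin N) ℂ) × GaugeField P j (Matrix.specialUnitaryGroup (Fin N) ℂ))),
      Measurable Φ ∧ Measurable J ∧ MeasurableSet S ∧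
      (∀ z ∈ S, (blockAvg (P := P) (j := j) (expMeanLogSU (n := Fin N))).avg (Φ z) = z.1 ∧
        Φ z ∈ {U : GaugeField P j (Matrix.specialUnitaryGroup (Fin N) ℂ) | ∀ c i, dist1 (loopHol U c i) < ε}) ∧
      ∀ (ρ : Density P j (Matrix.specialUnitaryGroup (Fin N) ℂ)),
        Integrable ρ (fieldMeasure P j (Matrix.specialUnitaryGroup (Fin N) ℂ)) →
        (∀ U, U ∉ {U : GaugeField P j (Matrix.specialUnitaryGroup (Fin N) ℂ) | ∀ c i, dist1 (loopHol U c i) < ε} → ρ U = 0) →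
        rnTransport (blockAvg (P := P) (j := j) (expMeanLogSU (n := Fin N))).avg ρ
            =ᵐ[fieldMeasure P (j + 1) (Matrix.specialUnitaryGroup (Fin N) ℂ)] fun V =>
          ∫ U', S.indicator (fun z => (J z : ℝ) * ρ (Φ z)) (V, U') ∂(fieldMeasure P j (Matrix.specialUnitaryGroup (Fin N) ℂ)) := by
  obtain ⟨Φ, J, S, hΦm, hJm, hSm, hfib, -, hT⟩ := exists_chart_rnTransport_ae_eq (N := N) hj hε0 hε hεI hεδ
  exact ⟨Φ, J, S, hΦm, hJm, hSm, hfib, hT⟩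

end Chart

/-! ## §4 The window inclusion at the trivial history: `{χB_k(triv′) ≠ 0} ⊆ O_ε` (the displayed `hO` of the local rows, at the record) -/

section Window

variable {G : Type} [GaugeGroup G]

open Summit.QuantumFields.Balaban3D.Carriers (Omega Omega_triv plaqCover)
open Summit.QuantumFields.Balaban3D.Proofs.Bound55Masses (chiB)

/-- At the trivial new history the small-field factor `χB_k(triv′)` of (49) cuts to GLOBAL plaquette smallness: `P_k = ∅` (`Hist.last_triv`) and
`Ω_k(triv′) = T` (`Carriers.Omega_triv`), so `χB_k(triv′)(U) ≠ 0 ⇒ |U(∂p) − 1| < ε₁(k)` for EVERY plaquette. [cite: Balaban1985UV3, (7) p.257 + (49) p.268] -/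
theorem plaqSmall_of_chiB_triv_ne_zero (M₁ : ℕ) (Rcol : ℕ → ℕ) (εS : ℕ → ℝ) (k : ℕ) (U : GaugeField P k G)
    (h : chiB M₁ Rcol εS k (Hist.triv P (k + 1)) U ≠ 0) : PlaqSmall (εS k) U := by
  classical
  by_cases hall : ∀ p : Plaq P k, p ∉ (Hist.triv P (k + 1)).last →
      plaqCover p ⊆ Omega M₁ Rcol (k + 1) (Hist.triv P (k + 1)) k →
      dist1 (GaugeField.plaqHol U p) < εS k
  · exact fun p => hall p (by simp) (by rw [Omega_triv]; exact Set.subset_univ _)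
  · exact absurd (show chiB M₁ Rcol εS k (Hist.triv P (k + 1)) U = 0 by unfold chiB; rw [if_neg hall]) h

/-- **THE WINDOW INCLUSION `{χB_k(triv′) ≠ 0} ⊆ O_ε`** — the displayed `hO` of `PinnedStepTrivPins.fibre55WinAC_triv_of_localChart` ∕
`fibre57LowOnAC_of_localChart` at the record's cut-off, under the SIZE condition `((d+2)L)²·ε₁(k)/4 < ε` (`0 ≤ ε₁(k)`): small plaquettes make every
loop variable of (0.4) small (`LatticeWordStokes.dist1_loopHol_le`). [cite: Balaban1987RG1, (0.4) p.253] -/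
theorem loopSmall_of_chiB_triv_ne_zero (M₁ : ℕ) (Rcol : ℕ → ℕ) (εS : ℕ → ℝ) (k : ℕ) (hεS : 0 ≤ εS k) {ε : ℝ}
    (hε : ((((P.d + 2) * P.L : ℕ) : ℝ) ^ 2 / 4) * εS k < ε) (U : GaugeField P k G)
    (h : chiB M₁ Rcol εS k (Hist.triv P (k + 1)) U ≠ 0) :
    U ∈ {U : GaugeField P k G | ∀ c i, dist1 (loopHol U c i) < ε} :=
  fun c i => (LatticeWordStokes.dist1_loopHol_le hεS (plaqSmall_of_chiB_triv_ne_zero M₁ Rcol εS k U h) c i).trans_lt hε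

end Window

end Summit.QuantumFields.YangMills.Theorems.BlockAvgEMLWeightedFibreChart

end
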